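import Summits.BirchSwinnertonDyer.BirchSwinnertonDyer.Theses.KatoDescentTamePotSupersingular
import Summits.BirchSwinnertonDyer.BirchSwinnertonDyer.Theorems.KatoDescentTamePotSupersingularDefs
import Literature.NumberTheory.EllipticCurves.Rank1Residual.PrintShapeTorsion
import Literature.NumberTheory.EllipticCurves.Rank1Residual.Predicates
import Literature.NumberTheory.EllipticCurves.NonEisensteinPrimeOfSurjective
import Literature.NumberTheory.EllipticCurves.Fouquet2025.OrdinaryCongruenceRankZeroBSD
import HarnessLib

/-!
# Route `KatoDescentTamePotSupersingular` (rung K8, sub-rung B4 (t′), cell `bsd-potss`): the Fouquet-2025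
# congruence-transport road to the crux `TameLowerHalfRankZero` (L₀, item stmt-BirchSwinnertonDyer-19981)
# over ONE cite-level composite reading fact instead of two hypothesis SHAPES and three descent readings
# (a `--supports … --as helper` file; seat bsd-potss-k8t-c2, generation 5)

Seats g3/g4 of this chair ran the road «congruent good-ordinary Skinner–Urban seed `G` + Fouquet 2025
Thm 4.1 (1)⇒(2) ⇒ Kato's Conj. 12.10 for `(f_W, p)` ⇒ image-free descent ⇒ BSD_p(W)» in the kernel
(p431286 `…TameLowerFouquetRoad`, p437352 `…TameLowerFouquetRoadExact`) modulo the SHAPES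
`FouquetTransportShapeExact KMC` / `OrdinarySeedReadsKMC KMC` over the interface `KMC` (Kato's main
conjecture as an abstract predicate — the definition item `defn-KatoMainConjecture`, D-O6-2, is blocked) and
the three descent readings `DescentCountReading` / `RealizableOfKMC` / `ReadsTrivialKMC`. The cell's referee
graded the three READINGS of print behind that chain PASS (bsd-potss-ref g21 §4: R1 level/weight lowering ⇒
ordinary companion, R2 Skinner–Urban Thm 3.6.4 verbatim, R3 Fouquet Thm 1.7/4.1 + Ass. 2.9/3.4 + Kato §17.13)
and ruled (g22 §4) that «nothing blocks the composite-reading-fact typing on referee grounds»; the tenure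
planner asked for the implication «IMC at a rank-0 congruent seed ∧ Ass. 2.9/3.4 on the row ⟹ L₀-row» over
Literature names (INBOX 2026-08-26T07:17:43Z (2)) to file it as a support split-child of 19981.

This file does exactly that:

* §1 = the composite reading as ONE named Literature fact `def … : Prop` (D-0014; nothing asserted; file
  `Literature/NumberTheory/EllipticCurves/Fouquet2025/OrdinaryCongruenceRankZeroBSD.lean`, p446173), in the tree's vocabulary, with the
  eligibility and PARTNER binders DISPLAYED (referee g21 §4: «the SETTLED-BY-CITATION pattern … is sound
  ONLY over the displayed eligibility + partner binders»): for `W` additive at `p ≥ 5` of analytic rank `0`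
  with `ρ̄_{W,p}` onto, Fouquet's Ass. 2.9 (2) exactly (`p`-division polynomial without a root in `ℚ_p`),
  Ass. 3.4 on the unramified Steinberg primes, and an elliptic curve `G`, good ORDINARY at `p`, `G[p]`
  irreducible, a ramified Steinberg prime, `ρ_{G,p^∞}` onto, `a_ℓ(G) ≡ a_ℓ(W) (mod p)` off `p N_W N_G`,
  every bad prime `≠ p` of `G` dividing `N_W` — the `p`-part of the BSD formula for `W` in the print shape
  of the tree's bsd.S30 (`L(W,1)/Ω = q`, `ord_p q = ord_p #Ш + v_p Tam − 2 v_p #tors`). Sources of the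
  chain: Skinner–Urban 2014 Thm 3.6.9 + Kato 2004 Thm 17.4 / §17.13 (the seed's Conj. 12.10 on the
  cyclotomic `ℤ_p`-line), Fouquet 2025 Thm 4.1 (1)⇒(2) + Thm 1.7 (2) (transport + TNC_p at the rank-0
  point), Venjakob 2007 §3.1 (3.14) after Burns–Flach (TNC_p for `h¹(E)(1)` ⟺ BSD_p, `Ш` finite, `p ≠ 2`).
* §2 unpacks it on the route's census predicates (`Theorems.FouquetGenericAt`, `FouquetEligibleAt`,
  `IsCongruentModP`, `FouquetLevelCompatibleAt` of the route Defs, p430678/p436983, and the Literature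
  predicates `Addv` / `Surj` / `GoodOrd` / `Irr` / `Ram`): the fact's binders ARE these predicates unfolded,
  so the bridge is definitional; then Miller's `BSD(W,p)`, `MissingPPartAt W p` (BOTH halves) and the crux's
  currency `MissingLowerBoundAt W p` on every additive rank-`0` row with such a seed, from the fact +
  modularity + GZK only.
* §3 the class form = VERBATIM the conclusion of g4's `tameLowerHalf_fouquetSeedRows_of_shapes` (p437352 §3,
  the split-child statement of memo FINDING-19981-ass29 §4), now with hypotheses (fact, GZK, modularity) —
  no `KMC`, no shape, no descent reading.

Census (evidence on the item, N < 5·10⁵): the rows of (t′) carrying such a seed are the ordinary-shape cell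
`L_{II*,5}` (Kodaira II* at `5`, `v₅(c₄) = 4`): 429 rank-`0` rows, 85 with `25 ∣ #Ш_an`, 335 (70 content) with
a certified elliptic good-ordinary partner (`TAME-L0-CENSUS-k8t-c2-g3.md`, `TAME-ASS29-CENSUS-k8t-c2-g4.tsv`;
kit j253026: Ass. 2.9 (2) holds on 429/429). HONEST FRAMING: conditional on a cite-level reading fact (no
`_holds`: Taylor–Wiles–Kisin patching, Nakamura's zeta morphism, Skinner–Urban's Eisenstein congruences are
programme-sized); the item 19981 is NOT closed (its class statement — Kato's Conj. 12.10 lower inclusion at an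
additive potentially supersingular prime — is an open problem off this cell); nothing is booked; BSD is not
proved by any of this. Seat `bsd-potss-k8t-c2` (prover-bsd-potss-k8t-c2-g5-0).

References: [Fouquet2025EquivariantTNC] Conj. 1.1 (p. 3), example (iii) (p. 5), Thm 1.7 (p. 7), Ass. 2.9 and
§2.4.1 (p. 15), Ass. 3.4 (pp. 22–23), Thm 4.1 and Cor. 4.2 (pp. 24–25); [SkinnerUrban2014] Thm 3.6.4 (p. 43),
Conj. 3.6.8 / Thm 3.6.9 (p. 45), Thm 3.6.11 (p. 46); [Kato2004Asterisque] 12.1 (p. 220), Conj. 12.10 (p. 224),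
Thm 17.4 (p. 273), Conj. 17.6 (p. 274), §17.13 (pp. 279–280); [Venjakob2007BSDviaETNC] §3.1, Prop. 3.9,
(3.13)–(3.14) (LMS LNS 320 pp. 348–353 of the survey); [Miller2011LMS] Def. 1.1.
-/

set_option autoImplicit false
-- sibling precedent (`KatoDescentTamePotSupersingularAssembly.lean`): the directory name repeats the summit name
set_option linter.dupNamespace false

noncomputable section

open scoped Classical

namespace Summit.BirchSwinnertonDyer.BirchSwinnertonDyer.Theorems

open WeierstrassCurve Literature.NumberTheory.EllipticCurves
  Literature.NumberTheory.EllipticCurves.ModularForms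
  Literature.NumberTheory.EllipticCurves.Rank1Residual
  Literature.NumberTheory.EllipticCurves.Rank1Residual.Typed
  Summit.BirchSwinnertonDyer.Rank1Residual.Additive
  Summit.BirchSwinnertonDyer.Rank1Residual
  Summit.BirchSwinnertonDyer.BirchSwinnertonDyer.Theses.KatoDescentTamePotSupersingular

/-! ## §1 The composite reading fact lives in `Literature/NumberTheory/EllipticCurves/Fouquet2025/OrdinaryCongruenceRankZeroBSD.lean`
(`Literature.NumberTheory.EllipticCurves.Fouquet2025.padicValRat_bsd_rank_zero_of_ordinaryCongruence`, p446173; statement,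
verbatim sources, derivation (α)–(γ), dictionary and referee flag there). -/

/-! ## §2 The road over the fact: BSD_p, both halves, and the crux's currency on a seed row -/

/-- **Bridge (definitional): the fact's binders are the route's census predicates unfolded.** On an additive
row `W` at `p ≥ 5` with `ρ̄` onto, `FouquetGenericAt p W`, `FouquetEligibleAt p W`, and a congruent
level-compatible good-ordinary seed `G` (`GoodOrd`, `Irr`, `Ram`, `ρ_{G,p^∞}` onto, `IsCongruentModP`,
`FouquetLevelCompatibleAt`), `L(W,1) ≠ 0` and `Ш(W)` finite, the composite fact gives the print shape
`PPartRankZero W p`. Conditional on the cite-level fact `hF`; nothing credited.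
[cite: Fouquet2025EquivariantTNC, Thm 4.1 and Thm 1.7 (2)] [cite: SkinnerUrban2014, Thm 3.6.9 (p. 45)] -/
theorem pPartRankZero_of_fouquetOrdinaryCongruence
    (hF : Fouquet2025.padicValRat_bsd_rank_zero_of_ordinaryCongruence)
    (W G : WeierstrassCurve ℚ) [W.IsElliptic] [W.IsGloballyMinimal] [G.IsElliptic] [G.IsGloballyMinimal]
    (p : ℕ) [Fact p.Prime] (hp : 5 ≤ p) (hadd : Addv W p) (hsurj : Surj W p) (hgen : FouquetGenericAt p W)
    (helig : FouquetEligibleAt p W) (hord : GoodOrd G p) (hirrG : Irr G p) (hramG : Ram G p)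
    (htowG : ∀ n : ℕ, G.HasSurjectiveModNGaloisRep (p ^ n : ℕ)) (hcong : IsCongruentModP p W G)
    (hlev : FouquetLevelCompatibleAt p W G) (hL : W.entireLFunction 1 ≠ 0) (hfin : Finite W.sha) :
    PPartRankZero W p :=
  hF W G p hp hadd.1 hadd.2 hsurj hgen helig hord.1 hord.2 hirrG hramG htowG hcong hlev hL hfin

/-- **Miller's `BSD(W,p)` on an additive rank-`0` row at `p ≥ 5` with a congruent good-ordinary Fouquet
seed**, from the composite fact + modularity (`L(W,1) = L^{(0)}(W,1) ≠ 0`) + Gross–Zagier–Kolyvagin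
(`Ш` finite, rank `0`), via the cell's bridge `bsdp_of_pPartRankZero`. Conditional; nothing credited.
[cite: Fouquet2025EquivariantTNC, Thm 1.7 (2) (p. 7)] [cite: Miller2011LMS, Def. 1.1] -/
theorem bsdp_rankZero_of_fouquetOrdinaryCongruence
    (hF : Fouquet2025.padicValRat_bsd_rank_zero_of_ordinaryCongruence) (hmod : hasEntireLFunction_rat)
    (hGZK : rank_eq_analyticRank_of_analyticRank_le_one)
    (W G : WeierstrassCurve ℚ) [W.IsElliptic] [W.IsGloballyMinimal] [G.IsElliptic] [G.IsGloballyMinimal]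
    (p : ℕ) [Fact p.Prime] (hp : 5 ≤ p) (hr : W.analyticRank = 0) (hadd : Addv W p) (hsurj : Surj W p)
    (hgen : FouquetGenericAt p W) (helig : FouquetEligibleAt p W) (hord : GoodOrd G p) (hirrG : Irr G p)
    (hramG : Ram G p) (htowG : ∀ n : ℕ, G.HasSurjectiveModNGaloisRep (p ^ n : ℕ))
    (hcong : IsCongruentModP p W G) (hlev : FouquetLevelCompatibleAt p W G) : BSDp W p := by
  have hfin : Finite W.sha := (hGZK W (by omega)).2
  have hL : W.entireLFunction 1 ≠ 0 := by
    rw [← W.leadingLCoeff_eq_of_analyticRank_eq_zero hr]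
    exact W.leadingLCoeff_ne_zero_holds (hmod W)
  exact bsdp_of_pPartRankZero W p hmod hGZK hr
    (pPartRankZero_of_fouquetOrdinaryCongruence hF W G p hp hadd hsurj hgen helig hord hirrG hramG htowG hcong
      hlev hL hfin)

/-- **`MissingPPartAt W p` — BOTH halves, `ord_p #Ш(W) = ord_p #Ш_an(W)` — on an additive rank-`0` row at
`p ≥ 5` with a congruent good-ordinary Fouquet seed** (so on these rows the U₀ item 19982 needs no
Tamagawa/Manin proviso either). Conditional on the cite-level fact; nothing credited.
[cite: Fouquet2025EquivariantTNC, Thm 1.7 (2) (p. 7)] [cite: Miller2011LMS, Def. 1.1] -/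
theorem missingPPartAt_rankZero_of_fouquetOrdinaryCongruence
    (hF : Fouquet2025.padicValRat_bsd_rank_zero_of_ordinaryCongruence) (hmod : hasEntireLFunction_rat)
    (hGZK : rank_eq_analyticRank_of_analyticRank_le_one)
    (W G : WeierstrassCurve ℚ) [W.IsElliptic] [W.IsGloballyMinimal] [G.IsElliptic] [G.IsGloballyMinimal]
    (p : ℕ) [Fact p.Prime] (hp : 5 ≤ p) (hr : W.analyticRank = 0) (hadd : Addv W p) (hsurj : Surj W p)
    (hgen : FouquetGenericAt p W) (helig : FouquetEligibleAt p W) (hord : GoodOrd G p) (hirrG : Irr G p)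
    (hramG : Ram G p) (htowG : ∀ n : ℕ, G.HasSurjectiveModNGaloisRep (p ^ n : ℕ))
    (hcong : IsCongruentModP p W G) (hlev : FouquetLevelCompatibleAt p W G) : MissingPPartAt W p := by
  haveI : Finite W.sha := (hGZK W (by omega)).2
  exact missingPPartAt_of_bsdp W p
    (bsdp_rankZero_of_fouquetOrdinaryCongruence hF hmod hGZK W G p hp hr hadd hsurj hgen helig hord hirrG hramG
      htowG hcong hlev)

/-- **The crux's currency: `MissingLowerBoundAt W p` (`ord_p #Ш_an ≤ ord_p #Ш`) on an additive rank-`0` row at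
`p ≥ 5` with a congruent good-ordinary Fouquet seed** — item 19981 restricted to its Fouquet-seed rows (by the
census the (t′) cell II* at `5`, `v₅(c₄) = 4`), from ONE cite-level fact + modularity + GZK. Conditional; the
item is NOT closed. [cite: Fouquet2025EquivariantTNC, Thm 4.1 (pp. 24–25)] [cite: Miller2011LMS, Def. 1.1] -/
theorem tameMissingLowerBoundAt_of_fouquetOrdinaryCongruence
    (hF : Fouquet2025.padicValRat_bsd_rank_zero_of_ordinaryCongruence) (hmod : hasEntireLFunction_rat)
    (hGZK : rank_eq_analyticRank_of_analyticRank_le_one)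
    (W G : WeierstrassCurve ℚ) [W.IsElliptic] [W.IsGloballyMinimal] [G.IsElliptic] [G.IsGloballyMinimal]
    (p : ℕ) [Fact p.Prime] (hp : 5 ≤ p) (hr : W.analyticRank = 0) (hadd : Addv W p) (hsurj : Surj W p)
    (hgen : FouquetGenericAt p W) (helig : FouquetEligibleAt p W) (hord : GoodOrd G p) (hirrG : Irr G p)
    (hramG : Ram G p) (htowG : ∀ n : ℕ, G.HasSurjectiveModNGaloisRep (p ^ n : ℕ))
    (hcong : IsCongruentModP p W G) (hlev : FouquetLevelCompatibleAt p W G) : MissingLowerBoundAt W p :=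
  (lower_and_upper_of_missingPPartAt W p
    (missingPPartAt_rankZero_of_fouquetOrdinaryCongruence hF hmod hGZK W G p hp hr hadd hsurj hgen helig hord
      hirrG hramG htowG hcong hlev)).1

/-! ## §3 The class form on the (t′) Fouquet-seed rows — the split-child statement, now over named facts only -/

/-- **L₀ on every (t′) rank-`0` row at `p ≥ 5` with `ρ̄` onto, Ass. 2.9 (2) (exact) and Ass. 3.4 that HAS a
level-compatible congruent good-ordinary Skinner–Urban seed** — VERBATIM the conclusion of seat g4's
`tameLowerHalf_fouquetSeedRows_of_shapes` (p437352 §3; the split-child statement of memo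
FINDING-19981-ass29 §4 offered to the planner), whose hypotheses (two SHAPES over `KMC`, three descent
readings, bsd.S21) are REPLACED by the single cite-level composite fact `hF` + GZK + modularity. The (t′)
binder `SubTprime` is carried for the item's shape and is idle in the proof (the fact is cell-free).
Conditional on `hF`; nothing credited; the item 19981 is NOT closed (open problem off these rows).
[cite: Fouquet2025EquivariantTNC, Thm 4.1 and Thm 1.7 (2)] [cite: SkinnerUrban2014, Thm 3.6.9 (p. 45)]
[cite: Kato2004Asterisque, §17.13 (p. 280)] [cite: Venjakob2007BSDviaETNC, §3.1 (3.14)] [cite: Miller2011LMS, Def. 1.1] -/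
theorem tameLowerHalf_fouquetSeedRows_of_fact
    (hF : Fouquet2025.padicValRat_bsd_rank_zero_of_ordinaryCongruence)
    (hGZK : rank_eq_analyticRank_of_analyticRank_le_one) (hmod : hasEntireLFunction_rat) :
    ∀ (W : WeierstrassCurve ℚ) [W.IsElliptic] [W.IsGloballyMinimal] (p : ℕ) [Fact p.Prime],
      W.analyticRank = 0 → 5 ≤ p → Addv W p → SubTprime W p → Surj W p → FouquetGenericAt p W →
      FouquetEligibleAt p W →
      (∃ (G : WeierstrassCurve ℚ) (_ : G.IsElliptic) (_ : G.IsGloballyMinimal),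
        GoodOrd G p ∧ Irr G p ∧ Ram G p ∧ (∀ n : ℕ, G.HasSurjectiveModNGaloisRep (p ^ n : ℕ)) ∧
          IsCongruentModP p W G ∧ FouquetLevelCompatibleAt p W G) →
      MissingLowerBoundAt W p := by
  intro W _ _ p _ hr hp hadd _ hsurj hgen helig hseed
  obtain ⟨G, hGe, hGm, hord, hirrG, hramG, htowG, hcong, hlev⟩ := hseed
  exact tameMissingLowerBoundAt_of_fouquetOrdinaryCongruence hF hmod hGZK W G p hp hr hadd hsurj hgen helig
    hord hirrG hramG htowG hcong hlev

/-- **Both halves on the same rows** (`MissingPPartAt`, i.e. `ord_p #Ш = ord_p #Ш_an`): the class form the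
U₀ side (item 19982 / node `TameUpperDefectRankZero`) may also consume on the Fouquet-seed rows — no
`p ∤ Tam·c_D` proviso, no parity clause. Conditional on `hF`; nothing credited.
[cite: Fouquet2025EquivariantTNC, Thm 1.7 (2) (p. 7)] [cite: Miller2011LMS, Def. 1.1] -/
theorem tameMissingPPartAt_fouquetSeedRows_of_fact
    (hF : Fouquet2025.padicValRat_bsd_rank_zero_of_ordinaryCongruence)
    (hGZK : rank_eq_analyticRank_of_analyticRank_le_one) (hmod : hasEntireLFunction_rat) :
    ∀ (W : WeierstrassCurve ℚ) [W.IsElliptic] [W.IsGloballyMinimal] (p : ℕ) [Fact p.Prime],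
      W.analyticRank = 0 → 5 ≤ p → Addv W p → SubTprime W p → Surj W p → FouquetGenericAt p W →
      FouquetEligibleAt p W →
      (∃ (G : WeierstrassCurve ℚ) (_ : G.IsElliptic) (_ : G.IsGloballyMinimal),
        GoodOrd G p ∧ Irr G p ∧ Ram G p ∧ (∀ n : ℕ, G.HasSurjectiveModNGaloisRep (p ^ n : ℕ)) ∧
          IsCongruentModP p W G ∧ FouquetLevelCompatibleAt p W G) →
      MissingPPartAt W p := by
  intro W _ _ p _ hr hp hadd _ hsurj hgen helig hseed
  obtain ⟨G, hGe, hGm, hord, hirrG, hramG, htowG, hcong, hlev⟩ := hseed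
  exact missingPPartAt_rankZero_of_fouquetOrdinaryCongruence hF hmod hGZK W G p hp hr hadd hsurj hgen helig
    hord hirrG hramG htowG hcong hlev

end Summit.BirchSwinnertonDyer.BirchSwinnertonDyer.Theorems

end
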